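import Mathlib
import Literature.AlgebraicGeometry.Resolution.BoundedPreparation
import Literature.AlgebraicGeometry.Resolution.SolvableVertexCurve
import Literature.AlgebraicGeometry.Resolution.AxialUnitChainLaw
import HarnessLib

/-!
# Bounded preparedness ascends through the blowing up of the curve `V(y, u₁)` (CJS Lemma 12.4 (3) / 13.2 (3))

Topic: `Literature/AlgebraicGeometry/Resolution`. Cossart–Jannsen–Saito, LNM 2270, Lemma 12.4 (3)
(printed p. 166: "If `(f, y, u)` is `𝐯`-prepared (resp. `δ`-prepared, resp. totally prepared), so is
`(f′, y′, u)`") and Lemma 13.2 (3) (the curve steps of a fundamental unit), Cossart–Piltant 2008,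
Lemma 4.5 (1) ("`Δ(E′; u₁, u₂; z′)` is the translated image of `Δ(E; u₁, u₂; z)` by one unit to the
left, so `Δ(E′; u₁, u₂; z′)` remains prepared"): along the blowing up of the permissible curve
`V(y, u₁)` read at the point of the strict transform of `div(y)` (`c′₁ = φ u₁`, `φ y = φ u₁ · y′`,
`c′₂ = φ u₂`), vertices move by `T(a₁, a₂) = (a₁ − 1, a₂)` with the same initial forms, so
preparedness of all vertices of abscissa `≤ B` at `x` gives preparedness of all vertices of abscissa
`≤ B − 1` at `x′`, in the TRANSPORTED coordinates. Companion of `PreparednessTransport.lean` (the point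
chart). PROVED here (no facts, no definitions):

* `forall_pts_of_forall_pts_colon_curve` — supporting half-planes descend: `p₁ x₁ + p₂ x₂ ≥ w₀′` on
  `pts c′ J′ μ` gives `p₁ x₁ + p₂ x₂ ≥ w₀′ + L p₁` on `pts c J μ` (`J ⊆ (y, u₁)^μ`).
* `exists_pts_on_line_of_colon_curve` — a line carrying a Newton point of `J′` pulls back to a line
  carrying one of `J`.
* `preparedUpTo_colon_curve` — **`PreparedUpTo c J μ B ⇒ PreparedUpTo c′ J′ μ (B − L)`** for
  `J ⊆ (y, u₁)^μ`, residue field onto, `L ≤ B` (solvability descends by `isSolvableAt_of_curveChart`).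

AI-written; weaker than expert review.

## Sources

* V. Cossart, U. Jannsen, S. Saito, LNM 2270 (2020), Lemma 12.4 (3)–(4), Lemma 13.2 (3).
  [CossartJannsenSaito2020]
* V. Cossart, O. Piltant, J. Algebra 320 (2008), Lemma 4.5 (1). [CossartPiltant2008]
-/

noncomputable section

open IsLocalRing MvPolynomial

namespace Literature.AlgebraicGeometry.Resolution

universe u

section Chart

variable {R R' : Type u} [CommRing R] [CommRing R'] (φ : R →+* R') {c : Fin 3 → R}
  {c' : Fin 3 → R'} (h₁ : c' 1 = φ (c 1)) (h₀ : φ (c 0) = φ (c 1) * c' 0)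
  (h₂ : c' 2 = φ (c 2))
  [IsRegularLocalRing R] [IsRegularLocalRing R']
  (hgen : Ideal.span {c 0, c 1, c 2} = maximalIdeal R) (hdim : ringKrullDim R = 3)
  (hgen' : Ideal.span {c' 0, c' 1, c' 2} = maximalIdeal R') (hdim' : ringKrullDim R' = 3)
  {J : Ideal R} {μ : ℕ}

include h₁ h₀ h₂ hgen hdim hgen' hdim' in
/-- **Supporting half-planes descend from the weak transform**: if every Newton point of
`J′ = (J R′ : (φ u₁)^μ)` for `(y′, u₁, u₂′)` satisfies `p₁ x₁ + p₂ x₂ ≥ w₀′` (`w₀′, p₁, p₂ > 0`), then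
every Newton point of `J ⊆ (y, u₁)^μ` for `(y, u₁, u₂)` satisfies `p₁ x₁ + p₂ x₂ ≥ w₀′ + L p₁` — the
pull-back of the half-plane under `T(a₁, a₂) = (a₁ − 1, a₂)`.
[cite: CossartJannsenSaito2020, Lemma 12.4 (4)] -/
theorem forall_pts_of_forall_pts_colon_curve (hJμ : J ≤ Ideal.span {c 0, c 1} ^ μ) {w₀' p₁ p₂ : ℕ} (hw₀' : 0 < w₀')
    (hp₁ : 0 < p₁) (hp₂ : 0 < p₂)
    (hS' : ∀ e ∈ pts c' ((J.map φ).colon {φ (c 1) ^ μ}) μ, w₀' ≤ p₁ * spt₁ μ e + p₂ * spt₂ μ e) :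
    ∀ e ∈ pts c J μ, w₀' + μ.factorial * p₁ ≤ p₁ * spt₁ μ e + p₂ * spt₂ μ e := by
  set W' := levelWeight μ w₀' p₁ p₂ with hW'
  have hW'pos : ∀ i, 0 < W' i := levelWeight_pos hw₀' hp₁ hp₂
  have hJ' := (le_weightedIdealW_levelWeight_iff c' hgen' hdim' _ hw₀' hp₁ hp₂).mpr hS'
  have hgenr := span_range_eq_of_span_triple c hgen
  have hpb : levelWeight μ (w₀' + μ.factorial * p₁) p₁ p₂ = curvePullbackWeight W' :=
    levelWeight_eq_curvePullbackWeight μ w₀' p₁ p₂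
  refine (le_weightedIdealW_levelWeight_iff c hgen hdim J (by positivity) hp₁ hp₂).mp ?_
  intro f hfJ
  obtain ⟨g, hg⟩ := exists_eq_pow_mul_of_mem_pPow φ h₀ (hJμ hfJ)
  have hgJ' : g ∈ (J.map φ).colon {φ (c 1) ^ μ} := by
    rw [Submodule.mem_colon_singleton, smul_eq_mul, mul_comm, ← hg]
    exact Ideal.mem_map_of_mem _ hfJ
  have hgF : g ∈ weightedIdealW c' W' (w₀' * μ) := hJ' hgJ'
  -- `φ f = (φ u₁)^μ g ∈ F′_{w₀′μ + μ W′₁}`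
  have hmon : φ (c 1) ^ μ = monom3 c' (Finsupp.single 1 μ) := by simp [monom3, h₁]
  have hwt : Finsupp.weight W' (Finsupp.single 1 μ) = μ * W' 1 := by
    rw [Finsupp.weight_apply, Finsupp.sum_single_index (by simp), smul_eq_mul]
  have hφf : φ f ∈ weightedIdealW c' W' ((w₀' + μ.factorial * p₁) * μ) := by
    rw [hg, hmon]
    have h1 : monom3 c' (Finsupp.single 1 μ) ∈ weightedIdealW c' W' (μ * W' 1) :=
      monomial_mem_weightedIdealW c' W' (by rw [hwt])
    have := weightedIdealW_mul_le c' W' _ _ (Ideal.mul_mem_mul h1 hgF)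
    refine weightedIdealW_antitone c' W' (le_of_eq ?_) this
    rw [hW', levelWeight_one]; ring
  have := mem_weightedIdealW_of_map_mem_curve φ h₁ h₀ h₂ W' hgen hdim hgen' hdim' hW'pos hφf
  rwa [← hpb] at this

include h₁ h₀ h₂ hgen hdim hgen' hdim' in
/-- **If the line `p₁ x₁ + p₂ x₂ = w₀′` carries a Newton point of `J′`, its pull-back
`p₁ x₁ + p₂ x₂ = w₀′ + L p₁` carries a Newton point of `J`** (`J ⊆ (y, u₁)^μ`): otherwise the
polygon of `J` lies in the half-plane one unit higher, and so does its transform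
(`colon_le_weightedIdealW_of_le_curve`), contradicting the point on the line.
[cite: CossartJannsenSaito2020, Lemma 12.4 (4)] -/
theorem exists_pts_on_line_of_colon_curve (hJμ : J ≤ Ideal.span {c 0, c 1} ^ μ) {w₀' p₁ p₂ : ℕ} (hw₀' : 0 < w₀')
    (hp₁ : 0 < p₁) (hp₂ : 0 < p₂)
    (hS' : ∀ e ∈ pts c' ((J.map φ).colon {φ (c 1) ^ μ}) μ, w₀' ≤ p₁ * spt₁ μ e + p₂ * spt₂ μ e)
    {e' : Fin 3 →₀ ℕ} (he' : e' ∈ pts c' ((J.map φ).colon {φ (c 1) ^ μ}) μ)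
    (hline' : p₁ * spt₁ μ e' + p₂ * spt₂ μ e' = w₀') :
    ∃ e ∈ pts c J μ, p₁ * spt₁ μ e + p₂ * spt₂ μ e = w₀' + μ.factorial * p₁ := by
  by_contra hnone
  push Not at hnone
  have hS := forall_pts_of_forall_pts_colon_curve φ h₁ h₀ h₂ hgen hdim hgen' hdim' hJμ hw₀' hp₁ hp₂ hS'
  -- all points of `J` lie one level higher
  have hS1 : ∀ e ∈ pts c J μ, (w₀' + μ.factorial * p₁ + 1) ≤ p₁ * spt₁ μ e + p₂ * spt₂ μ e := by
    intro e he
    have h1 := hS e he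
    have h2 := hnone e he
    omega
  set W' := levelWeight μ w₀' p₁ p₂ with hW'
  have hW'pos : ∀ i, 0 < W' i := levelWeight_pos hw₀' hp₁ hp₂
  have hJ := (le_weightedIdealW_levelWeight_iff c hgen hdim J (by positivity) hp₁ hp₂).mpr hS1
  -- transport to `x′` with the weight `W″ = (w₀′ + 1, L p₁, L p₂)`: `J′ ⊆ F′^{W″}_{(w₀′ + 1) μ}`
  set W'' := levelWeight μ (w₀' + 1) p₁ p₂ with hW''
  have hW''pos : ∀ i, 0 < W'' i := levelWeight_pos (by omega) hp₁ hp₂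
  have hpb : levelWeight μ (w₀' + μ.factorial * p₁ + 1) p₁ p₂ = curvePullbackWeight W'' := by
    have := levelWeight_eq_curvePullbackWeight μ (w₀' + 1) p₁ p₂
    rw [show w₀' + 1 + μ.factorial * p₁ = w₀' + μ.factorial * p₁ + 1 by ring] at this
    rw [this]
  have hJ2 : J ≤ weightedIdealW c (curvePullbackWeight W'') ((w₀' + 1) * μ + μ * W'' 1) := by
    rw [← hpb]
    refine hJ.trans (weightedIdealW_antitone c _ (le_of_eq ?_))
    rw [hW'', levelWeight_one]; ring
  have hJ'le := colon_le_weightedIdealW_of_le_curve φ h₁ h₀ h₂ W'' hgen' hdim' hW''pos hJ2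
  obtain ⟨⟨g, hgJ', w, hw, hinit⟩, he'0⟩ := he'
  have hmem := hJ'le hgJ'
  -- `e′` is `W′`-initial for `g` (it minimises the line functional), hence of `W″`-weight `≥ (w₀′+1)μ`
  have hmin : ∀ x ∈ pts c' ((J.map φ).colon {φ (c 1) ^ μ}) μ,
      p₁ * spt₁ μ e' + p₂ * spt₂ μ e' ≤ p₁ * spt₁ μ x + p₂ * spt₂ μ x := by
    intro x hx; rw [hline']; exact hS' x hx
  have hinit' := isInitialTerm_levelWeight_of_isMinOn c' hgen' hdim' hp₁ hp₂ ⟨⟨g, hgJ', w, hw, hinit⟩, he'0⟩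
    hmin (by rw [hline']; exact hw₀') hgJ' hw hinit
  rw [hline'] at hinit'
  have hle := le_weight_of_isInitialTerm_of_mem c' hgen' hdim' hW'pos hW''pos hinit' hmem
  -- but `weight W″ e′ = weight W′ e′ + e′₀ = w₀′ μ + e′₀ < (w₀′ + 1) μ`
  have heq : Finsupp.weight W' e' = w₀' * μ := by
    rw [hW']; exact (weight_levelWeight_eq_iff_spt he'0 w₀' p₁ p₂).mpr hline'
  have hrel : Finsupp.weight W'' e' = Finsupp.weight W' e' + e' 0 := by
    rw [hW'', hW', weight_levelWeight, weight_levelWeight]; ring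
  rw [hrel, heq] at hle
  nlinarith

include h₁ h₀ h₂ hgen hdim hgen' hdim' in
/-- **BOUNDED PREPAREDNESS ASCENDS THROUGH THE CURVE CHART** (CJS Lemma 12.4 (3) / 13.2 (3), for all
vertices at once): if `(y, u₁, u₂)` is prepared at every vertex of scaled abscissa `≤ B` (`J ⊆ (y, u₁)^μ`,
`L ≤ B`) and the residue field of the near point `x′` of the blowing up of `V(y, u₁)` is that of `x`,
then the TRANSPORTED system `(y′, φ u₁, φ u₂)` is prepared at every vertex of scaled abscissa `≤ B − L`.
[cite: CossartJannsenSaito2020, Lemma 12.4 (3)] [cite: CossartPiltant2008, Lemma 4.5 (1)] -/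
theorem preparedUpTo_colon_curve [IsLocalHom φ] (hψ : Function.Surjective (ResidueField.map φ))
    (hJμ : J ≤ Ideal.span {c 0, c 1} ^ μ) {B : ℕ} (hB : μ.factorial ≤ B) (hprep : PreparedUpTo c J μ B) :
    PreparedUpTo c' ((J.map φ).colon {φ (c 1) ^ μ}) μ (B - μ.factorial) := by
  set J' : Ideal R' := (J.map φ).colon {φ (c 1) ^ μ} with hJ'
  intro w₀' p₁ p₂ hw₀' hp₁ hp₂ hS' v₁' v₂' hB' hline' hreal' huniq' lam' hsol'
  obtain ⟨e', he', he'1, he'2⟩ := hreal'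
  set W' := levelWeight μ w₀' p₁ p₂ with hW'
  have hW'pos : ∀ i, 0 < W' i := levelWeight_pos hw₀' hp₁ hp₂
  -- the pulled-back line and a point of `J` on it
  have hS := forall_pts_of_forall_pts_colon_curve φ h₁ h₀ h₂ hgen hdim hgen' hdim' hJμ hw₀' hp₁ hp₂ hS'
  have hline'e : p₁ * spt₁ μ e' + p₂ * spt₂ μ e' = w₀' := by rw [he'1, he'2, hline']; ring
  obtain ⟨e, he, hele⟩ := exists_pts_on_line_of_colon_curve φ h₁ h₀ h₂ hgen hdim hgen' hdim' hJμ hw₀' hp₁ hp₂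
    hS' he' hline'e
  -- every point of `J` on the pulled-back line goes up to the vertex `L(v₁′, v₂′)`
  have hpb : levelWeight μ (w₀' + μ.factorial * p₁) p₁ p₂ = curvePullbackWeight W' :=
    levelWeight_eq_curvePullbackWeight μ w₀' p₁ p₂
  have key : ∀ x ∈ pts c J μ, p₁ * spt₁ μ x + p₂ * spt₂ μ x = w₀' + μ.factorial * p₁ →
      spt₁ μ x = μ.factorial * v₁' + μ.factorial ∧ spt₂ μ x = μ.factorial * v₂' := by
    intro x hx hxline
    obtain ⟨⟨f, hfJ, w, hw, hinit⟩, hx0⟩ := hx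
    have hmin : ∀ z ∈ pts c J μ, p₁ * spt₁ μ x + p₂ * spt₂ μ x ≤ p₁ * spt₁ μ z + p₂ * spt₂ μ z := by
      intro z hz; rw [hxline]; exact hS z hz
    have hinit' := isInitialTerm_levelWeight_of_isMinOn c hgen hdim hp₁ hp₂ ⟨⟨f, hfJ, w, hw, hinit⟩, hx0⟩
      hmin (by rw [hxline]; positivity) hfJ hw hinit
    rw [hxline, hpb] at hinit'
    have hx' := curvePt_mem_pts φ h₁ h₀ h₂ W' hgen hdim hgen' hdim' hW'pos hJμ hfJ hx0 hinit'
    have h01 : μ ≤ x 0 + x 1 :=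
      le_add_of_isInitialTerm_of_mem_span_pair_pow c hgen hdim hw (hJμ hfJ) hinit
    have hs1 := spt₁_curvePt_add hx0 h01
    have hs2 := spt₂_curvePt μ x
    have honline : p₁ * spt₁ μ (curvePt μ x) + p₂ * spt₂ μ (curvePt μ x) = w₀' := by
      have : p₁ * (spt₁ μ (curvePt μ x) + μ.factorial) + p₂ * spt₂ μ (curvePt μ x) =
          w₀' + μ.factorial * p₁ := by rw [hs1, hs2, ← hxline]
      nlinarith
    obtain ⟨h1, h2⟩ := huniq' _ hx' honline
    rw [hs2] at h2
    refine ⟨?_, h2⟩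
    have : spt₁ μ (curvePt μ x) + μ.factorial = μ.factorial * v₁' + μ.factorial := by rw [h1]
    rw [hs1] at this; exact this
  obtain ⟨he1, he2⟩ := key e he hele
  -- the vertex at `x`: `(v₁, v₂) = (v₁′ + 1, v₂′)`
  obtain ⟨t, ht⟩ := hψ lam'
  obtain ⟨lam, rfl⟩ := residue_surjective t
  rw [ResidueField.map_residue] at ht
  subst ht
  refine hprep (w₀' + μ.factorial * p₁) p₁ p₂ (by positivity) hp₁ hp₂ hS (v₁' + 1) v₂' ?_ ?_
    ⟨e, he, by rw [he1, Nat.mul_succ], he2⟩ ?_ (residue R lam) ?_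
  · rw [Nat.mul_succ]; omega
  · rw [hline']; ring
  · intro x hx hxline
    obtain ⟨hx1, hx2⟩ := key x hx hxline
    exact ⟨by rw [hx1, Nat.mul_succ], hx2⟩
  · have hsol'' : IsSolvableAt c' J' W' (μ * W' 0) μ (vexp (v₁' + 1 - 1) v₂') (residue R' (φ lam)) := by
      rw [Nat.add_sub_cancel, hW', levelWeight_zero, mul_comm]; exact hsol'
    have hvW : Finsupp.weight (curvePullbackWeight W') (vexp (v₁' + 1) v₂') = curvePullbackWeight W' 0 := by
      rw [← hpb, weight_vexp, levelWeight_zero, levelWeight_one, levelWeight_two, hline']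
      ring
    have hdesc := isSolvableAt_of_curveChart φ h₁ h₀ h₂ W' hgen hdim hgen' hdim' hW'pos hψ hJμ
      (v₁ := v₁' + 1) (v₂ := v₂') (by omega) hvW hsol''
    rw [← hpb, levelWeight_zero] at hdesc
    rw [show (w₀' + μ.factorial * p₁) * μ = μ * (w₀' + μ.factorial * p₁) from mul_comm _ _]
    exact hdesc

end Chart

end Literature.AlgebraicGeometry.Resolution

end
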